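import Summits.MatrixMultiplication.MatrixMultiplication.Theorems.SoloBlindMassPowerset

/-!
# (K₃) and Conjecture E in the all-present case, in every corank

Sub-programme (K₃) / Conjecture E (K3.31).  `G` of exponent `3`, `B` sum-distinct for `h`, `X` disjoint from `B`,
`S = B ∪ X` (corank `m = |X|`, every rank).  Suppose that ALL `2^m` shifted targets `τ - ∑_{x ∈ C} h x` (`C ⊆ X`) have
a `B`-representation `A C`.  Then:

* `soloBlind_allPresent_type` — TYPE RIGIDITY: if an index `i` lies in `A C₀` but not in `A (C₀ ∪ {x})`, then for
  every `C ⊆ X`, `i ∈ A C ↔ x ∉ C` (one quadruple rigidity `soloBlind_rep_rigidity` per `C`).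
* `soloBlind_kraft_allPresent` — (K₃): if `h` is zero-sum free on `S` then `K(τ; S) ≤ 1`.  Zero-sum-freeness gives,
  for each `x ∈ X`, an index `i_x ∈ A ∅ \ A {x}`, hence of type `[x ∉ C]`; these are pairwise distinct, so
  `|A C| ≥ m - |C|` and `K = ∑_C 2^{-|C|} 2^{-|A C|} ≤ 2^m · 2^{-m} = 1` (`soloBlind_mass_union_powerset`).
* `soloBlind_conjE_allPresent` — CONJECTURE E: if moreover `τ` is H-good on `S` then `E(τ; S) ≤ 1/2`: H-goodness
  gives `e ∈ A ∅ ∩ A X`, which by type rigidity lies in every `A C` and differs from the `i_x`, so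
  `|A C| ≥ m - |C| + 1`.

So in every corank the whole difficulty of (K₃) / Conjecture E sits in the partial-presence patterns (at corank two:
the kills `Q1, Q2, K-a, K-b, K-c` of `SoloBlindConjETwo`).
-/

namespace Summit.MatrixMultiplication.MatrixMultiplication.Theorems

open Finset

universe u

variable {ι : Type*} [DecidableEq ι]
variable {G : Type u} [AddCommGroup G] [DecidableEq G]

/-- TYPE RIGIDITY in the all-present case: an index in `A C₀ \ A (C₀ ∪ {x})` has membership pattern `[x ∉ C]`. -/
theorem soloBlind_allPresent_type (three : ∀ g : G, g + g + g = 0) {h : ι → G} {B X : Finset ι}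
    (hdist : ∀ A ⊆ B, ∀ A' ⊆ B, ∑ i ∈ A, h i = ∑ i ∈ A', h i → A = A') {τ : G} {A : Finset ι → Finset ι}
    (hA : ∀ C ⊆ X, A C ∈ soloBlindSeqRepAll h B (τ - ∑ i ∈ C, h i))
    {x : ι} (hx : x ∈ X) {C₀ : Finset ι} (hC₀ : C₀ ⊆ X) (hxC₀ : x ∉ C₀)
    {i : ι} (hi : i ∈ A C₀) (hi' : i ∉ A (insert x C₀)) :
    ∀ C ⊆ X, (i ∈ A C ↔ x ∉ C) := by
  -- first for every `C ∌ x`: `i ∈ A C` and `i ∉ A (C ∪ {x})`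
  have key : ∀ C ⊆ X, x ∉ C → i ∈ A C ∧ i ∉ A (insert x C) := by
    intro C hC hxC
    have rep : ∀ {D : Finset ι}, D ⊆ X → A D ⊆ B ∧ ∑ j ∈ A D, h j = τ - ∑ j ∈ D, h j :=
      fun hD => soloBlind_mem_seqRepAll.mp (hA _ hD)
    have hxC' : insert x C ⊆ X := Finset.insert_subset hx hC
    have hxC₀' : insert x C₀ ⊆ X := Finset.insert_subset hx hC₀
    obtain ⟨hPB, hPs⟩ := rep hC
    obtain ⟨hQB, hQs⟩ := rep hxC₀'
    obtain ⟨hRB, hRs⟩ := rep hxC'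
    obtain ⟨hTB, hTs⟩ := rep hC₀
    have e : ∑ j ∈ A C, h j + ∑ j ∈ A (insert x C₀), h j =
        ∑ j ∈ A (insert x C), h j + ∑ j ∈ A C₀, h j := by
      rw [hPs, hQs, hRs, hTs, Finset.sum_insert hxC, Finset.sum_insert hxC₀]
      abel
    obtain ⟨hI, hD⟩ := soloBlind_rep_rigidity three hdist hPB hRB hTB hQB e
    -- `hI : A C ∩ A (insert x C₀) = A (insert x C) ∩ A C₀`, `hD : Δ's agree`
    have hiR : i ∉ A (insert x C) := by
      intro hiR
      have : i ∈ A (insert x C) ∩ A C₀ := Finset.mem_inter.mpr ⟨hiR, hi⟩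
      rw [← hI] at this
      exact hi' (Finset.mem_inter.mp this).2
    refine ⟨?_, hiR⟩
    have : i ∈ A (insert x C) \ A C₀ ∪ A C₀ \ A (insert x C) :=
      Finset.mem_union_right _ (Finset.mem_sdiff.mpr ⟨hi, hiR⟩)
    rw [← hD] at this
    rcases Finset.mem_union.mp this with h1 | h2
    · exact (Finset.mem_sdiff.mp h1).1
    · exact absurd (Finset.mem_sdiff.mp h2).1 hi'
  intro C hC
  by_cases hxC : x ∈ C
  · have e : C = insert x (C.erase x) := (Finset.insert_erase hxC).symm
    have k := key (C.erase x) ((Finset.erase_subset x C).trans hC) (Finset.notMem_erase x C)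
    rw [e]
    exact ⟨fun h' => absurd h' k.2, fun h' => absurd (Finset.mem_insert_self x _) h'⟩
  · exact ⟨fun _ => hxC, fun _ => (key C hC hxC).1⟩

/-- In the all-present case with `h` zero-sum free: for each `x ∈ X` an index of `B` of type `[x ∉ C]`. -/
theorem soloBlind_allPresent_witness (three : ∀ g : G, g + g + g = 0) {h : ι → G} {B X : Finset ι}
    (hd : Disjoint B X)
    (hdist : ∀ A ⊆ B, ∀ A' ⊆ B, ∑ i ∈ A, h i = ∑ i ∈ A', h i → A = A')
    (zsf : ∀ T ⊆ B ∪ X, T.Nonempty → ∑ i ∈ T, h i ≠ 0) {τ : G} {A : Finset ι → Finset ι}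
    (hA : ∀ C ⊆ X, A C ∈ soloBlindSeqRepAll h B (τ - ∑ i ∈ C, h i)) {x : ι} (hx : x ∈ X) :
    ∃ i ∈ B, ∀ C ⊆ X, (i ∈ A C ↔ x ∉ C) := by
  obtain ⟨h0B, h0s⟩ := soloBlind_mem_seqRepAll.mp (hA ∅ (Finset.empty_subset X))
  have hxX : ({x} : Finset ι) ⊆ X := Finset.singleton_subset_iff.mpr hx
  obtain ⟨h1B, h1s⟩ := soloBlind_mem_seqRepAll.mp (hA {x} hxX)
  have hxB : x ∉ B := fun hxB => Finset.disjoint_left.mp hd hxB hx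
  -- `A ∅ ⊄ A {x}`: otherwise `(A {x} \ A ∅) ∪ {x}` is a zero-sum
  have hns : ¬ A ∅ ⊆ A {x} := by
    intro hsub
    have hxA : x ∉ A {x} \ A ∅ := fun h' => hxB (h1B (Finset.mem_sdiff.mp h').1)
    refine zsf (insert x (A {x} \ A ∅))
      (Finset.insert_subset (Finset.mem_union_right B hx)
        (Finset.sdiff_subset.trans (h1B.trans Finset.subset_union_left)))
      (Finset.insert_nonempty x _) ?_
    rw [Finset.sum_insert hxA, Finset.sum_sdiff_eq_sub hsub, h1s, h0s, Finset.sum_singleton, Finset.sum_empty]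
    abel
  obtain ⟨i, hi, hi'⟩ := Finset.not_subset.mp hns
  exact ⟨i, h0B hi, soloBlind_allPresent_type three hdist hA hx (Finset.empty_subset X)
    (Finset.notMem_empty x) hi (by simpa using hi')⟩

/-- (K₃) IN THE ALL-PRESENT CASE, EVERY CORANK (exponent `3`): `B` sum-distinct, `X` disjoint from `B`, `h`
zero-sum free on `B ∪ X`, every shifted target `τ - ∑_C h` (`C ⊆ X`) represented in `B` ⟹ `K(τ; B ∪ X) ≤ 1`. -/
theorem soloBlind_kraft_allPresent (three : ∀ g : G, g + g + g = 0) {h : ι → G} {B X : Finset ι}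
    (hd : Disjoint B X)
    (hdist : ∀ A ⊆ B, ∀ A' ⊆ B, ∑ i ∈ A, h i = ∑ i ∈ A', h i → A = A')
    (zsf : ∀ T ⊆ B ∪ X, T.Nonempty → ∑ i ∈ T, h i ≠ 0) {τ : G} {A : Finset ι → Finset ι}
    (hA : ∀ C ⊆ X, A C ∈ soloBlindSeqRepAll h B (τ - ∑ i ∈ C, h i)) :
    soloBlindMass h (B ∪ X) τ ≤ 1 := by
  have hex : ∀ x, x ∈ X → ∃ i ∈ B, ∀ C ⊆ X, (i ∈ A C ↔ x ∉ C) :=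
    fun x hx => soloBlind_allPresent_witness three hd hdist zsf hA hx
  choose! f hfB hf using hex
  -- `f` is injective on `X` and `f '' (X \ C) ⊆ A C`
  have finj : ∀ x ∈ X, ∀ y ∈ X, f x = f y → x = y := by
    intro x hx y hy e
    by_contra hxy
    have h1 : f x ∉ A {x} := fun h' => ((hf x hx {x} (Finset.singleton_subset_iff.mpr hx)).mp h')
      (Finset.mem_singleton_self x)
    have h2 : f y ∈ A {x} := (hf y hy {x} (Finset.singleton_subset_iff.mpr hx)).mpr
      (fun h' => hxy (Finset.mem_singleton.mp h').symm)
    exact h1 (e ▸ h2)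
  have hcard : ∀ C ∈ X.powerset, X.card - C.card ≤ (A C).card := by
    intro C hC
    have hCX : C ⊆ X := Finset.mem_powerset.mp hC
    have hsub : (X \ C).image f ⊆ A C := by
      intro j hj
      obtain ⟨y, hy, rfl⟩ := Finset.mem_image.mp hj
      exact (hf y (Finset.mem_sdiff.mp hy).1 C hCX).mpr (Finset.mem_sdiff.mp hy).2
    have hinj : Set.InjOn f ↑(X \ C) := fun y hy y' hy' e =>
      finj y (Finset.mem_sdiff.mp (Finset.mem_coe.mp hy)).1 y' (Finset.mem_sdiff.mp (Finset.mem_coe.mp hy')).1 e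
    calc X.card - C.card = (X \ C).card := (Finset.card_sdiff_of_subset hCX).symm
      _ = ((X \ C).image f).card := (Finset.card_image_of_injOn hinj).symm
      _ ≤ (A C).card := Finset.card_le_card hsub
  have hw : ∀ C ∈ X.powerset, soloBlindMass h B (τ - ∑ i ∈ C, h i) ≤ (1 / 2 : ℚ) ^ (X.card - C.card) :=
    fun C hC => soloBlind_mass_le_pow_of_rep hdist (hA C (Finset.mem_powerset.mp hC)) (hcard C hC)
  refine (soloBlind_mass_union_powerset_le h hd τ hw).trans ?_
  have e : ∀ C ∈ X.powerset, (1 / 2 : ℚ) ^ C.card * (1 / 2 : ℚ) ^ (X.card - C.card) = (1 / 2 : ℚ) ^ X.card := by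
    intro C hC
    rw [← pow_add, Nat.add_sub_cancel' (Finset.card_le_card (Finset.mem_powerset.mp hC))]
  rw [Finset.sum_congr rfl e, Finset.sum_const, Finset.card_powerset, nsmul_eq_mul]
  rw [Nat.cast_pow, ← mul_pow]
  norm_num

/-- CONJECTURE E IN THE ALL-PRESENT CASE, EVERY CORANK (exponent `3`): as in `soloBlind_kraft_allPresent`, with `τ`
H-good on `B ∪ X` ⟹ `E(τ; B ∪ X) ≤ 1/2`. -/
theorem soloBlind_conjE_allPresent (three : ∀ g : G, g + g + g = 0) {h : ι → G} {B X : Finset ι}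
    (hd : Disjoint B X)
    (hdist : ∀ A ⊆ B, ∀ A' ⊆ B, ∑ i ∈ A, h i = ∑ i ∈ A', h i → A = A')
    (zsf : ∀ T ⊆ B ∪ X, T.Nonempty → ∑ i ∈ T, h i ≠ 0) {τ : G}
    (hgood : ∀ T ⊆ B ∪ X, ∑ i ∈ T, h i ≠ τ + τ) {A : Finset ι → Finset ι}
    (hA : ∀ C ⊆ X, A C ∈ soloBlindSeqRepAll h B (τ - ∑ i ∈ C, h i)) :
    soloBlindMass h (B ∪ X) τ ≤ 1 / 2 := by
  have hex : ∀ x, x ∈ X → ∃ i ∈ B, ∀ C ⊆ X, (i ∈ A C ↔ x ∉ C) :=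
    fun x hx => soloBlind_allPresent_witness three hd hdist zsf hA hx
  choose! f hfB hf using hex
  have finj : ∀ x ∈ X, ∀ y ∈ X, f x = f y → x = y := by
    intro x hx y hy e
    by_contra hxy
    have h1 : f x ∉ A {x} := fun h' => ((hf x hx {x} (Finset.singleton_subset_iff.mpr hx)).mp h')
      (Finset.mem_singleton_self x)
    have h2 : f y ∈ A {x} := (hf y hy {x} (Finset.singleton_subset_iff.mpr hx)).mpr
      (fun h' => hxy (Finset.mem_singleton.mp h').symm)
    exact h1 (e ▸ h2)
  -- H-goodness: `A ∅` and `A X` meet in some `e`, which then lies in every `A C`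
  obtain ⟨h0B, h0s⟩ := soloBlind_mem_seqRepAll.mp (hA ∅ (Finset.empty_subset X))
  obtain ⟨hXB, hXs⟩ := soloBlind_mem_seqRepAll.mp (hA X subset_rfl)
  have hmeet : ∃ e ∈ A ∅, e ∈ A X := by
    by_contra hne
    push Not at hne
    have hdj : Disjoint (A ∅) (A X) := Finset.disjoint_left.mpr (fun i hi hi' => hne i hi hi')
    have hdj' : Disjoint (A ∅ ∪ A X) X :=
      Finset.disjoint_of_subset_left (Finset.union_subset h0B hXB) hd
    refine hgood (A ∅ ∪ A X ∪ X)
      (Finset.union_subset ((Finset.union_subset h0B hXB).trans Finset.subset_union_left)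
        Finset.subset_union_right) ?_
    rw [Finset.sum_union hdj', Finset.sum_union hdj, h0s, hXs, Finset.sum_empty]
    abel
  obtain ⟨e, he0, heX⟩ := hmeet
  have heall : ∀ C ⊆ X, e ∈ A C := by
    intro C
    induction C using Finset.induction_on with
    | empty => exact fun _ => he0
    | @insert x C hxC ih =>
      intro hC
      have hx : x ∈ X := hC (Finset.mem_insert_self x C)
      have hCX : C ⊆ X := (Finset.subset_insert x C).trans hC
      by_contra hne
      have typ := soloBlind_allPresent_type three hdist hA hx hCX hxC (ih hCX) hne X subset_rfl
      exact (typ.mp heX) hx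
  have hef : ∀ y ∈ X, e ≠ f y := by
    intro y hy efy
    have h1 : f y ∉ A {y} := fun h' => ((hf y hy {y} (Finset.singleton_subset_iff.mpr hy)).mp h')
      (Finset.mem_singleton_self y)
    exact h1 (efy ▸ heall {y} (Finset.singleton_subset_iff.mpr hy))
  have hcard : ∀ C ∈ X.powerset, X.card - C.card + 1 ≤ (A C).card := by
    intro C hC
    have hCX : C ⊆ X := Finset.mem_powerset.mp hC
    have hsub : insert e ((X \ C).image f) ⊆ A C := by
      intro j hj
      rcases Finset.mem_insert.mp hj with rfl | hj
      · exact heall C hCX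
      · obtain ⟨y, hy, rfl⟩ := Finset.mem_image.mp hj
        exact (hf y (Finset.mem_sdiff.mp hy).1 C hCX).mpr (Finset.mem_sdiff.mp hy).2
    have hinj : Set.InjOn f ↑(X \ C) := fun y hy y' hy' e =>
      finj y (Finset.mem_sdiff.mp (Finset.mem_coe.mp hy)).1 y' (Finset.mem_sdiff.mp (Finset.mem_coe.mp hy')).1 e
    have henot : e ∉ (X \ C).image f := by
      intro he
      obtain ⟨y, hy, hye⟩ := Finset.mem_image.mp he
      exact hef y (Finset.mem_sdiff.mp hy).1 hye.symm
    calc X.card - C.card + 1 = (X \ C).card + 1 := by rw [Finset.card_sdiff_of_subset hCX]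
      _ = ((X \ C).image f).card + 1 := by rw [Finset.card_image_of_injOn hinj]
      _ = (insert e ((X \ C).image f)).card := (Finset.card_insert_of_notMem henot).symm
      _ ≤ (A C).card := Finset.card_le_card hsub
  have hw : ∀ C ∈ X.powerset,
      soloBlindMass h B (τ - ∑ i ∈ C, h i) ≤ (1 / 2 : ℚ) ^ (X.card - C.card + 1) :=
    fun C hC => soloBlind_mass_le_pow_of_rep hdist (hA C (Finset.mem_powerset.mp hC)) (hcard C hC)
  refine (soloBlind_mass_union_powerset_le h hd τ hw).trans ?_
  have e' : ∀ C ∈ X.powerset,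
      (1 / 2 : ℚ) ^ C.card * (1 / 2 : ℚ) ^ (X.card - C.card + 1) = (1 / 2 : ℚ) ^ X.card * (1 / 2) := by
    intro C hC
    rw [← pow_add, ← Nat.add_assoc, Nat.add_sub_cancel' (Finset.card_le_card (Finset.mem_powerset.mp hC)),
      pow_succ]
  rw [Finset.sum_congr rfl e', Finset.sum_const, Finset.card_powerset, nsmul_eq_mul, ← mul_assoc]
  rw [Nat.cast_pow, ← mul_pow]
  norm_num

end Summit.MatrixMultiplication.MatrixMultiplication.Theorems
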